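import Summits.Ventures.CertifiedArithmetic.LowPrec.GemmThetaLawGenMixAData

/-!
# E2M3×E2M1 law check, binades 6 and 7

HONEST FRAMING (venture CertifiedArithmetic / cell `pub-lowprec`, seat gemm, gen 12 → 13): certified
error envelopes and provably optimal rounding/accumulation schemes for low-precision formats under
stated cost models; every table by two implementations; no hardware or vendor claims.

Part 4/5 of the per-level kernel check of `e2m3e2m1Law.lawCheck` (see `GemmThetaLawGenMixAData.lean`):
levels `bin 6` and `bin 7` (1012 + 904 classes). [cell]
-/

namespace Literature.ComputerArithmetic.FloatingPoint

namespace MiniFloat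

namespace ThetaLaw

/-- Level `bin 6` of the E2M3×E2M1 law check passes (1012 classes, both signs, all 165 letters).
[cell, kernel `decide`] -/
theorem levCheck_e2m3e2m1_b6 : e2m3e2m1Law.levCheck (Lev.bin 6) = true := by
  decide +kernel

/-- Level `bin 7` of the E2M3×E2M1 law check passes (904 classes, both signs, all 165 letters).
[cell, kernel `decide`] -/
theorem levCheck_e2m3e2m1_b7 : e2m3e2m1Law.levCheck (Lev.bin 7) = true := by
  decide +kernel

end ThetaLaw

end MiniFloat

end Literature.ComputerArithmetic.FloatingPoint
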